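import Mathlib
import HarnessLib
import Summits.HubbardSuperconductivity.HubbardSuperconductivity.Theorems.KLProgrammeKLRegimeEngineScaleOneSrcProfileW
import Summits.HubbardSuperconductivity.HubbardSuperconductivity.Theorems.KLProgrammeKLRegimeVolumeLimitV11TowerDataOfSuppliers
import Summits.HubbardSuperconductivity.HubbardSuperconductivity.Theorems.KLProgrammeKLRegimeAlphaWtFlowDeep

/-!
# Route `KLProgramme` — crux K3, VL child `KLRegimeVolumeLimitV17F3` (stmt-HubbardSuperconductivity-23356), skeleton «cauchy» v12W-7 (e331b8c44158451f):
# THE UV ATOM `stub_vl_srcUVW` FROM ITS TWO LEVELS — level `0` DISCHARGED by p3 g21's frame-generic theorem, level `1` the remaining hypothesis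
# (seat hubbard-kl-k3c4-p1 g20, VL lead; `--supports` 23356)

The registered UV atom (history-bound, windowed currency; VL lead g20, p3 g21's located point «(VL)-HUV-FRAME») asks token #24-W at the levels `j = 0, 1` at the top
flow frame `K_top`, under the top history `HistP … 0 (n_β+1)`, the (K5′) clauses at `c″` and `Z^{K_top}_{Λ_{k+1}} ≠ 0`.  p3 g21's
`…EngineScaleOneSrcProfileW.exists_sourceProfilesAtLevF_srcWindow_zero` (p684624) gives the level `0` for EVERY `FrameOK` frame and every package above a threshold;
`FrameOK` of `K_top` follows from the history (`…AlphaWtFlowDeep.frameOK_klFlowFrameU_of_histP_le`).  Hence the atom splits: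
* **`srcUVW_of_levels (H0) (H1)`** — the registered text of `stub_vl_srcUVW` from a level-`0` supplier `H0` (= p684624's statement verbatim) and a level-`1` supplier
  `H1` (the SAME binder shape as the atom, restricted to `j = 1`, with the package quantified as `∀ Q, CE₁ ≤ Q.CE →` like p3's level `0`); one package
  `Q₀ := {Q with CE := max CE₀ CE₁}`, one amplitude `max A₀ A₁` (`klSrcBudget_mono_A`);
* **`srcUVW_of_levelOne (H1)`** — `H0` discharged BY NAME: the atom is now EXACTLY its level-`1` half (p3 g21's route (B), pen (R307)).
Quantifier threading; nothing asserts `H1`, the atom, VL, K3 or superconductivity. [cite: BenfattoGiulianiMastropietro2006, §2.7-§2.9]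
-/

noncomputable section

namespace Summit.HubbardSuperconductivity.HubbardSuperconductivity.Theorems.TwoVolumeSource

set_option linter.dupNamespace false -- summit = problem name (single-conjunct summit), D-0017

open Finset Filter Topology Literature.MathematicalPhysics.QuantumLattice GrassmannAlgebra Literature.Probability.LatticeModels
open Summit.HubbardSuperconductivity.HubbardSuperconductivity.Theorems.KLRegimeSplit
open Summit.HubbardSuperconductivity.HubbardSuperconductivity.Theorems.KLProgrammeLegKernels
open Summit.HubbardSuperconductivity.HubbardSuperconductivity.Theorems.EngineV8
open Summit.HubbardSuperconductivity.HubbardSuperconductivity.Theorems.TwoVolumeDefect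
open Summit.HubbardSuperconductivity.HubbardSuperconductivity.Theorems.TorusFourierL2

/-- **The UV atom from its two levels.**  `H0` = p3 g21's `exists_sourceProfilesAtLevF_srcWindow_zero` statement (level `0`, every `FrameOK` frame, every package above
`CE₀`); `H1` = the level-`1` supplier in the atom's own binder shape (history, (K5′) at `c″`, `Z ≠ 0`; package `∀ Q, CE₁ ≤ Q.CE`).
[folklore: quantifier threading; cite: BenfattoGiulianiMastropietro2006, §2.7-§2.9] -/
theorem srcUVW_of_levels
    (H0 : ∀ (P : SplitConsts) (R : RenConsts), P.WF → R.WF2 →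
      ∃ CE₀ : ℝ, 0 ≤ CE₀ ∧ ∃ c₀ : ℝ, 0 < c₀ ∧ ∀ c : ℝ, 0 < c → c ≤ c₀ → ∃ U₀ : ℝ, 0 < U₀ ∧
        ∀ μ ∈ klWindowC, ∀ U : ℝ, 0 < U → U ≤ U₀ → ∀ β : ℝ, klBetaMin ≤ β → β ≤ Real.exp (c / U ^ 2) →
          ∃ A₀ : ℝ, 1 ≤ A₀ ∧ ∀ (L M : ℕ) [NeZero L] [NeZero M], klEngL₃ β U ≤ L → klEngM₃ β U L ≤ M →
            ∀ K : TrigPolyC4v, FrameOK R U (nScales β) μ K → ∀ Q : EngConsts, CE₀ ≤ Q.CE →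
              SourceProfilesAtLevF L M (klSrcBudget P Q U (fun _ _ => A₀) 1) β U μ K (srcWindowFamily L M) 0 0 1)
    (H1 : ∀ (G : GeoConsts) (P : SplitConsts) (Q : EngConsts) (R : RenConsts), P.WF → R.WF2 → ∀ c'' : ℝ, 0 < c'' →
      ∃ CE₁ : ℝ, 0 ≤ CE₁ ∧ ∃ c₁ : ℝ, 0 < c₁ ∧ ∀ c : ℝ, 0 < c → c ≤ c₁ → ∃ U₁ : ℝ, 0 < U₁ ∧
        ∀ μ ∈ klWindowC, ∀ U : ℝ, 0 < U → U ≤ U₁ → ∀ β : ℝ, klBetaMin ≤ β → β ≤ Real.exp (c / U ^ 2) →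
          ∃ A₁ : ℝ, 0 ≤ A₁ ∧ ∃ L₁ : ℕ, ∃ M₁ : ℕ → ℕ, ∀ (L M : ℕ) [NeZero L] [NeZero M], L₁ ≤ L → M₁ L ≤ M →
            HistP klPredsV17F2 L M G P Q R β U μ 0 (nScales β + 1) →
            (∀ m : ℕ, 1 ≤ m → m < nScales β + 1 → FlowPieceOscAt L M c'' β U μ m) →
            (∀ k, k ≤ nScales β → hubbardEffPartitionFnCT L M β U μ 0 (klFlowFrameU L M β U μ (nScales β + 1)) (klScale klE0 (k + 1)) ≠ 0) →
            2 ≤ nScales β + 1 → ∀ Q' : EngConsts, CE₁ ≤ Q'.CE →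
              SourceProfilesAtLevF L M (klSrcBudget P Q' U (fun _ _ => A₁) 2) β U μ (klFlowFrameU L M β U μ (nScales β + 1)) (srcWindowFamily L M) 1 1 2) :
    ∀ (G : GeoConsts) (P : SplitConsts) (Q : EngConsts) (R : RenConsts), P.WF → R.WF2 → ∀ c'' : ℝ, 0 < c'' →
      ∃ Q₀ : EngConsts, 0 ≤ Q₀.CE ∧ ∃ c₀ : ℝ, 0 < c₀ ∧ ∀ c : ℝ, 0 < c → c ≤ c₀ → ∃ U₀ : ℝ, 0 < U₀ ∧
        ∀ μ ∈ klWindowC, ∀ U : ℝ, 0 < U → U ≤ U₀ → ∀ β : ℝ, klBetaMin ≤ β → β ≤ Real.exp (c / U ^ 2) →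
          ∃ A₀ : ℝ, 0 ≤ A₀ ∧ ∃ L₁ : ℕ, ∃ M₁ : ℕ → ℕ, ∀ (L M : ℕ) [NeZero L] [NeZero M], L₁ ≤ L → M₁ L ≤ M →
            HistP klPredsV17F2 L M G P Q R β U μ 0 (nScales β + 1) →
            (∀ m : ℕ, 1 ≤ m → m < nScales β + 1 → FlowPieceOscAt L M c'' β U μ m) →
            (∀ k, k ≤ nScales β → hubbardEffPartitionFnCT L M β U μ 0 (klFlowFrameU L M β U μ (nScales β + 1)) (klScale klE0 (k + 1)) ≠ 0) →
            ∀ j : ℕ, j ≤ 1 → j + 1 ≤ nScales β + 1 →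
              SourceProfilesAtLevF L M (klSrcBudget P Q₀ U (fun _ _ => A₀) (j + 1)) β U μ (klFlowFrameU L M β U μ (nScales β + 1)) (srcWindowFamily L M) j j (j + 1) := by
  intro G P Q R hP hR2 c'' hc''
  have hKl : 0 ≤ P.Klam := le_trans zero_le_one hP.1
  obtain ⟨CE₀, hCE₀, c₀, hc₀, h0⟩ := H0 P R hP hR2
  obtain ⟨CE₁, hCE₁, c₁, hc₁, h1⟩ := H1 G P Q R hP hR2 c'' hc''
  -- one package above both thresholds
  set Q₀ : EngConsts := { Q with CE := max CE₀ CE₁ } with hQ₀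
  have hQ₀CE : Q₀.CE = max CE₀ CE₁ := rfl
  have hQ₀0 : 0 ≤ Q₀.CE := by rw [hQ₀CE]; exact hCE₀.trans (le_max_left _ _)
  refine ⟨Q₀, hQ₀0, min c₀ c₁, lt_min hc₀ hc₁, fun c hc hcc => ?_⟩
  obtain ⟨U₀, hU₀, h0'⟩ := h0 c hc (hcc.trans (min_le_left _ _))
  obtain ⟨U₁, hU₁, h1'⟩ := h1 c hc (hcc.trans (min_le_right _ _))
  refine ⟨min U₀ U₁, lt_min hU₀ hU₁, fun μ hμ U hU hUU β hβmin hβc => ?_⟩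
  obtain ⟨A₀, hA₀, h0''⟩ := h0' μ hμ U hU (hUU.trans (min_le_left _ _)) β hβmin hβc
  obtain ⟨A₁, hA₁, L₁, M₁, h1''⟩ := h1' μ hμ U hU (hUU.trans (min_le_right _ _)) β hβmin hβc
  have hA₀0 : 0 ≤ A₀ := zero_le_one.trans hA₀
  refine ⟨max A₀ A₁, hA₀0.trans (le_max_left _ _), max (klEngL₃ β U) L₁, fun L => max (klEngM₃ β U L) (M₁ L), ?_⟩
  intro L M _ _ hL hM hhist hosc hZ j hj hjn
  have hL3 : klEngL₃ β U ≤ L := (le_max_left _ _).trans hL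
  have hM3 : klEngM₃ β U L ≤ M := (le_max_left _ _).trans hM
  have hL₁ : L₁ ≤ L := (le_max_right _ _).trans hL
  have hM₁ : M₁ L ≤ M := (le_max_right _ _).trans hM
  rcases Nat.le_one_iff_eq_zero_or_eq_one.1 hj with rfl | rfl
  · -- level 0: p3's frame-generic theorem at the top flow frame (`FrameOK` from the history)
    have hfr : FrameOK R U (nScales β) μ (klFlowFrameU L M β U μ (nScales β + 1)) :=
      frameOK_klFlowFrameU_of_histP_le hR2 (by omega) le_rfl le_rfl hhist
    exact (h0'' L M hL3 hM3 _ hfr Q₀ (by rw [hQ₀CE]; exact le_max_left _ _)).mono fun s m =>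
      klSrcBudget_mono_A P Q₀ U hQ₀0 hKl (fun _ _ => le_max_left A₀ A₁) 1 s m
  · -- level 1: the supplier `H1`
    exact (h1'' L M hL₁ hM₁ hhist hosc hZ (by omega) Q₀ (by rw [hQ₀CE]; exact le_max_right _ _)).mono fun s m =>
      klSrcBudget_mono_A P Q₀ U hQ₀0 hKl (fun _ _ => le_max_right A₀ A₁) 2 s m

/-- **The UV atom is EXACTLY its level-`1` half** (level `0` discharged by p3 g21's `exists_sourceProfilesAtLevF_srcWindow_zero`, p684624).
[cite: BenfattoGiulianiMastropietro2006, §2.7-§2.9] -/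
theorem srcUVW_of_levelOne
    (H1 : ∀ (G : GeoConsts) (P : SplitConsts) (Q : EngConsts) (R : RenConsts), P.WF → R.WF2 → ∀ c'' : ℝ, 0 < c'' →
      ∃ CE₁ : ℝ, 0 ≤ CE₁ ∧ ∃ c₁ : ℝ, 0 < c₁ ∧ ∀ c : ℝ, 0 < c → c ≤ c₁ → ∃ U₁ : ℝ, 0 < U₁ ∧
        ∀ μ ∈ klWindowC, ∀ U : ℝ, 0 < U → U ≤ U₁ → ∀ β : ℝ, klBetaMin ≤ β → β ≤ Real.exp (c / U ^ 2) →
          ∃ A₁ : ℝ, 0 ≤ A₁ ∧ ∃ L₁ : ℕ, ∃ M₁ : ℕ → ℕ, ∀ (L M : ℕ) [NeZero L] [NeZero M], L₁ ≤ L → M₁ L ≤ M →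
            HistP klPredsV17F2 L M G P Q R β U μ 0 (nScales β + 1) →
            (∀ m : ℕ, 1 ≤ m → m < nScales β + 1 → FlowPieceOscAt L M c'' β U μ m) →
            (∀ k, k ≤ nScales β → hubbardEffPartitionFnCT L M β U μ 0 (klFlowFrameU L M β U μ (nScales β + 1)) (klScale klE0 (k + 1)) ≠ 0) →
            2 ≤ nScales β + 1 → ∀ Q' : EngConsts, CE₁ ≤ Q'.CE →
              SourceProfilesAtLevF L M (klSrcBudget P Q' U (fun _ _ => A₁) 2) β U μ (klFlowFrameU L M β U μ (nScales β + 1)) (srcWindowFamily L M) 1 1 2) :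
    ∀ (G : GeoConsts) (P : SplitConsts) (Q : EngConsts) (R : RenConsts), P.WF → R.WF2 → ∀ c'' : ℝ, 0 < c'' →
      ∃ Q₀ : EngConsts, 0 ≤ Q₀.CE ∧ ∃ c₀ : ℝ, 0 < c₀ ∧ ∀ c : ℝ, 0 < c → c ≤ c₀ → ∃ U₀ : ℝ, 0 < U₀ ∧
        ∀ μ ∈ klWindowC, ∀ U : ℝ, 0 < U → U ≤ U₀ → ∀ β : ℝ, klBetaMin ≤ β → β ≤ Real.exp (c / U ^ 2) →
          ∃ A₀ : ℝ, 0 ≤ A₀ ∧ ∃ L₁ : ℕ, ∃ M₁ : ℕ → ℕ, ∀ (L M : ℕ) [NeZero L] [NeZero M], L₁ ≤ L → M₁ L ≤ M →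
            HistP klPredsV17F2 L M G P Q R β U μ 0 (nScales β + 1) →
            (∀ m : ℕ, 1 ≤ m → m < nScales β + 1 → FlowPieceOscAt L M c'' β U μ m) →
            (∀ k, k ≤ nScales β → hubbardEffPartitionFnCT L M β U μ 0 (klFlowFrameU L M β U μ (nScales β + 1)) (klScale klE0 (k + 1)) ≠ 0) →
            ∀ j : ℕ, j ≤ 1 → j + 1 ≤ nScales β + 1 →
              SourceProfilesAtLevF L M (klSrcBudget P Q₀ U (fun _ _ => A₀) (j + 1)) β U μ (klFlowFrameU L M β U μ (nScales β + 1)) (srcWindowFamily L M) j j (j + 1) :=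
  srcUVW_of_levels exists_sourceProfilesAtLevF_srcWindow_zero H1

end Summit.HubbardSuperconductivity.HubbardSuperconductivity.Theorems.TwoVolumeSource

end
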